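import Summits.Ventures.HodgeRepro2.T5UnimodularPerfect
import Summits.Ventures.HodgeRepro2.T5SL2Perfect
import Mathlib.Topology.Algebra.Group.Matrix

/-!
# `SL₂(ℝ)` is unimodular

`T5SL2Perfect`: `commutator (SL (Fin 2) F) = ⊤` for a field with an element `a ≠ 0`, `a² ≠ 1`;
`T5UnimodularPerfect`: a perfect locally compact group has trivial modular character and its
Haar measures are right- and inversion-invariant.  Here the two are put together for `SL₂`
over a locally compact Hausdorff topological field (`SL₂(F)` is a closed subgroup of the matrix
space, hence locally compact), and specialised to `SL₂(ℝ)` (second countable, so every left Haar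
measure is right-invariant with no regularity hypothesis).

This is the support map's «`U(1,1)` / `SU(1,1)` is unimodular» (N4.3 / B1) at the level of the
isomorphic group `SL₂(ℝ)`; the transport along the Cayley transform (a topological-group
isomorphism `SU(1,1) ≃ SL₂(ℝ)`) and Rühl's normalisation of the Haar measure are NOT in this
file.

Blind lane: Mathlib + own prefix only; no sorry; axioms ⊆ {propext, Classical.choice, Quot.sound}.
-/

namespace Summit.Ventures.HodgeRepro2.T5SL2Unimodular

open MeasureTheory MeasureTheory.Measure Matrix Topology

section general

variable {F : Type*} [Field F] [TopologicalSpace F] [IsTopologicalRing F] [T2Space F]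
  [LocallyCompactSpace F]

/-- The matrix space over a locally compact field is locally compact (finite product). -/
instance instLocallyCompactSpaceMatrix : LocallyCompactSpace (Matrix (Fin 2) (Fin 2) F) :=
  inferInstanceAs (LocallyCompactSpace (Fin 2 → Fin 2 → F))

/-- `SL₂(F)` is locally compact: it is closed in the matrix space. -/
instance instLocallyCompactSpaceSL : LocallyCompactSpace (SpecialLinearGroup (Fin 2) F) :=
  SpecialLinearGroup.isClosedEmbedding_val.locallyCompactSpace

/-- `SL₂(F)` is Hausdorff. -/
instance instT2SpaceSL : T2Space (SpecialLinearGroup (Fin 2) F) :=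
  SpecialLinearGroup.isClosedEmbedding_val.isEmbedding.t2Space

/-- **The modular character of `SL₂(F)` is trivial** for a locally compact field `F` with an
element `a ≠ 0`, `a² ≠ 1`. -/
theorem modularCharacterFun_eq_one (a : F) (ha : a ≠ 0) (ha2 : a ^ 2 ≠ 1)
    (g : SpecialLinearGroup (Fin 2) F) : modularCharacterFun g = 1 :=
  T5UnimodularPerfect.modularCharacterFun_eq_one_of_commutator_eq_top
    (T5SL2Perfect.commutator_eq_top a ha ha2) g

/-- **`SL₂(F)` is unimodular**: every inner regular left Haar measure is right-invariant. -/
theorem isMulRightInvariant (a : F) (ha : a ≠ 0) (ha2 : a ^ 2 ≠ 1)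
    [MeasurableSpace (SpecialLinearGroup (Fin 2) F)] [BorelSpace (SpecialLinearGroup (Fin 2) F)]
    (μ : Measure (SpecialLinearGroup (Fin 2) F)) [IsHaarMeasure μ] [InnerRegular μ] :
    IsMulRightInvariant μ :=
  T5UnimodularPerfect.isMulRightInvariant_of_commutator_eq_top
    (T5SL2Perfect.commutator_eq_top a ha ha2) μ

/-- Every inner regular left Haar measure on `SL₂(F)` is inversion-invariant. -/
theorem isInvInvariant (a : F) (ha : a ≠ 0) (ha2 : a ^ 2 ≠ 1)
    [MeasurableSpace (SpecialLinearGroup (Fin 2) F)] [BorelSpace (SpecialLinearGroup (Fin 2) F)]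
    (μ : Measure (SpecialLinearGroup (Fin 2) F)) [IsHaarMeasure μ] [InnerRegular μ] :
    IsInvInvariant μ :=
  T5UnimodularPerfect.isInvInvariant_of_commutator_eq_top
    (T5SL2Perfect.commutator_eq_top a ha ha2) μ

end general

section secondCountable

variable {F : Type*} [Field F] [TopologicalSpace F] [IsTopologicalRing F] [T2Space F]
  [SecondCountableTopology F]

/-- The matrix space `M₂(F)` over a second countable field is second countable. -/
instance instSecondCountableTopologyMatrix : SecondCountableTopology (Matrix (Fin 2) (Fin 2) F) :=
  inferInstanceAs (SecondCountableTopology (Fin 2 → Fin 2 → F))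

/-- `SL₂(F)` over a second countable field is second countable. -/
instance instSecondCountableTopologySL : SecondCountableTopology (SpecialLinearGroup (Fin 2) F) :=
  SpecialLinearGroup.isClosedEmbedding_val.isEmbedding.secondCountableTopology

end secondCountable

section real

/-- The modular character of `SL₂(ℝ)` is trivial. -/
theorem modularCharacterFun_eq_one_real (g : SpecialLinearGroup (Fin 2) ℝ) :
    modularCharacterFun g = 1 :=
  modularCharacterFun_eq_one (2 : ℝ) two_ne_zero (by norm_num) g

/-- `modularCharacter = 1` on `SL₂(ℝ)`. -/
theorem modularCharacter_eq_one_real :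
    (modularCharacter : SpecialLinearGroup (Fin 2) ℝ →* NNReal) = 1 :=
  T5UnimodularPerfect.modularCharacter_eq_one_of_commutator_eq_top
    T5SL2Perfect.commutator_eq_top_real

variable [MeasurableSpace (SpecialLinearGroup (Fin 2) ℝ)]
  [BorelSpace (SpecialLinearGroup (Fin 2) ℝ)]

/-- **`SL₂(ℝ)` is unimodular**: every left Haar measure is right-invariant (no regularity
hypothesis: `SL₂(ℝ)` is second countable). -/
theorem isMulRightInvariant_real (μ : Measure (SpecialLinearGroup (Fin 2) ℝ)) [IsHaarMeasure μ] :
    IsMulRightInvariant μ :=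
  T5UnimodularPerfect.isMulRightInvariant_of_commutator_eq_top_of_secondCountable
    T5SL2Perfect.commutator_eq_top_real μ

/-- Every left Haar measure on `SL₂(ℝ)` is inversion-invariant (a Haar measure on the
σ-compact metrizable `SL₂(ℝ)` is inner regular). -/
theorem isInvInvariant_real (μ : Measure (SpecialLinearGroup (Fin 2) ℝ)) [IsHaarMeasure μ] :
    IsInvInvariant μ :=
  haveI := isMulRightInvariant_real μ
  T5UnimodularPerfect.isInvInvariant_of_isMulRightInvariant μ

/-- `∫ f (x * g) ∂μ = ∫ f x ∂μ` for every left Haar measure `μ` on `SL₂(ℝ)`. -/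
theorem integral_mul_right_real (μ : Measure (SpecialLinearGroup (Fin 2) ℝ)) [IsHaarMeasure μ]
    {E : Type*} [NormedAddCommGroup E] [NormedSpace ℝ E]
    (f : SpecialLinearGroup (Fin 2) ℝ → E) (g : SpecialLinearGroup (Fin 2) ℝ) :
    ∫ x, f (x * g) ∂μ = ∫ x, f x ∂μ :=
  haveI := isMulRightInvariant_real μ
  integral_mul_right_eq_self f g

/-- `∫ f x⁻¹ ∂μ = ∫ f x ∂μ` for every left Haar measure `μ` on `SL₂(ℝ)`. -/
theorem integral_inv_real (μ : Measure (SpecialLinearGroup (Fin 2) ℝ)) [IsHaarMeasure μ]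
    {E : Type*} [NormedAddCommGroup E] [NormedSpace ℝ E] (f : SpecialLinearGroup (Fin 2) ℝ → E) :
    ∫ x, f x⁻¹ ∂μ = ∫ x, f x ∂μ :=
  haveI := isInvInvariant_real μ
  integral_inv_eq_self f μ

end real

end Summit.Ventures.HodgeRepro2.T5SL2Unimodular
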